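import Summits.BirchSwinnertonDyer.BirchSwinnertonDyer.Theorems.GoldfeldK12AdditiveTwoInertSevenKrizLi7Twist
import Summits.BirchSwinnertonDyer.Rank1Residual.X12.O11.RouteUEulerCriterionNat
import HarnessLib

set_option linter.dupNamespace false -- namespace `…BirchSwinnertonDyer.BirchSwinnertonDyer…` is the cell's (D-0017 nested layout)
set_option autoImplicit false

/-!
# K12₂″, the 7-INERT half — member `n = 53` of the Kriz–Li-on-the-twist rung: the FIRST NEW certificates
# (`49a1^{(−53)}`, `(−53/7) = −1`, auxiliary Heegner field `ℚ(√−47)`)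

Cell `bsd-goldfeld`, seat `bsd-goldfeld-s1p-c201` (prover, gen 8); `--supports` stmt-BirchSwinnertonDyer-20044 (K12₂″; registered stub
`stub_inertHalfGenusNonTorsion`). THESES-FREE sequel of `…GoldfeldK12AdditiveTwoInertSevenKrizLi7Twist` (p495876; class theorems A/B/C
for `W ≅ 49a1^{(−4n)}` over `ℚ(√−r)`) and `…Members` (p496839; `n = 1, 2, 22` from bsd-cm's certificates). Here the member
`n = 53`: `53` is the third prime (after 29 and 37) of the inert-half prime family `{ℓ ≡ 1 (4), (ℓ/7) = +1}` (memo K12PP-INERT7 / INERT-RUNG-DECISION;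
`7` is inert in `ℚ(√−53)`, so NO Heegner point of `X₀(49)` lives there and none of the cell's earlier rank-one theorems reaches it).
Kit j267736 Part B: `S₁(53) ≡ 21 (mod 49)` (cert₁) and the least admissible Heegner prime is `r = 47` (`47 ≡ 7 (8)`, `(−47/7) = 1`,
`(−47/53) = 1`) with `S₂(53,47) ≡ 14 (mod 49)` (cert₂; level `7·212·47 = 69748`, 7 blocks of `decide +kernel`, bsd-cm's
`RouteUMemberE20/E88` template verbatim: Euler's criterion in `ℕ`-arithmetic via `RouteU.jacobiSym_prime_eq_ite_nat`, assembly by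
`RouteU.norm_generalizedBernoulli_one_eq_one_of_cert_range`). Then: (K) every level-`N(W)` Heegner point of a globally minimal
model `W ≅ 49a1^{(−212)}` over `ℚ(√−47)` has infinite order (KL19 Thm. 1.20 only); (C′) K12₂″'s implication OUTRIGHT on these `W`
(+ Modularity, Gross–Zagier, Heegner rationality, `2`-parity); (≤) `r_an(W) ≤ 1` with no Selmer hypothesis (`= 1` by the sign law in the
cone sequel). HONEST FRAMING: `p = 7`, RANK axis; ONE witness member; nothing about `p = 2`; K12₂″ stays OPEN; BSD is not proved by any
of this. THEOREMS ONLY (no `def`, no instance, no named fact).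

References: [KrizLi2019] Thm. 1.20 (pp. 7–8), Rem. 1.21, §1.5 (1); [Washington1997] §5.1, Thm. 4.2; [Cox2013] §1.C Lemma 1.14;
[GrossZagier1986] I.(6.3), I.§7; [DokchitserDokchitserAnnals2010] Thm. 1.4.
-/

noncomputable section

open scoped Classical NumberTheorySymbols

open NumberField WeierstrassCurve DirichletCharacter
open Literature.NumberTheory.EllipticCurves Literature.NumberTheory.EllipticCurves.Rank1Residual
open Literature.NumberTheory.EllipticCurves.KrizLi2019 Literature.NumberTheory.LFunctions
open Literature.NumberTheory.EllipticCurves.ModularForms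
open Literature.NumberTheory.QuadraticFields
open Summit.BirchSwinnertonDyer.Rank1Residual
open Summit.BirchSwinnertonDyer.Rank1Residual.X12.O11.RouteU

namespace Summit.BirchSwinnertonDyer.BirchSwinnertonDyer.Theorems.GoldfeldGoodTwists

/-! ### Member `n = 53` (`49a1^{(−212)} ≅ 49a1^{(−53)}`, INERT half: `(−53/7) = −1`), Heegner prime `r = 47`
(`47 ≡ 7 (mod 8)`, `(−47/7) = 1`, `(−47/53) = 1`); levels `7·212 = 1484` and `7·212·47 = 69748` -/

/-- `ord₇ (7·212) = 1`. [folklore] -/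
theorem padicValNat_seven_level1_n53 : padicValNat 7 (7 * (4 * 53)) = 1 := by
  rw [padicValNat.mul (by norm_num) (by norm_num), padicValNat_self, padicValNat.eq_zero_of_not_dvd (by norm_num)]

/-- `ord₇ (7·212·47) = 1`. [folklore] -/
theorem padicValNat_seven_level2_n53 : padicValNat 7 (7 * (4 * 53) * 47) = 1 := by
  rw [show (7 * (4 * 53) * 47 : ℕ) = 7 * (212 * 47) by norm_num, padicValNat.mul (by norm_num) (by norm_num),
    padicValNat_self, padicValNat.eq_zero_of_not_dvd (by norm_num)]

/-- **The Kronecker value of `D = −212` in reciprocity form**: `[a odd]·(−53/a) = χ₄(a)·(a/53)` (`53 ≡ 1 (mod 4)`).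
[cite: Cox2013, §1.C Lemma 1.14 and (1.15)–(1.18)] -/
theorem kroneckerVal_n53_eq (a : ℕ) :
    (if Even a then (0 : ℤ) else J(-((53 : ℕ) : ℤ) | a)) = (if a % 2 = 0 then (0 : ℤ) else if a % 4 = 1 then 1 else -1) * J((a : ℤ) | 53) := by
  by_cases ha0 : Even a
  · rw [if_pos ha0, if_pos (Nat.even_iff.mp ha0), zero_mul]
  · have ha : Odd a := Nat.not_even_iff_odd.mp ha0
    rw [if_neg ha0]
    rw [jacobiSym_neg_eq_χ₄_mul (n := 53) (by norm_num) ha, ZMod.χ₄_nat_eq_if_mod_four]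

set_option maxRecDepth 400000 in
/-- **`‖B_{1,θ₁}‖₇ = 1`** for every character `θ₁` mod `7·212` with values `χ_{−212}(j)·ω(j)⁴`, `ω` Teichmüller (certificate
`7 ∥ Σ_{j<1484} χ_{−212}(j) j²⁹ ≡ 21 (mod 49)`, `decide +kernel`; = c301's Heegner-half invariant `S(53)`, kit j267736).
[cite: KrizLi2019, Thm. 1.20 (p. 8) and §1.5 (1)] [cite: Washington1997, §5.1 and Thm. 4.2] -/
theorem norm_generalizedBernoulli_theta1_n53 (ω : DirichletCharacter ℚ_[7] 7)
    (hω : IsTeichmullerCharacter ω) (θ : DirichletCharacter ℚ_[7] (7 * (4 * 53)))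
    (hθ : ∀ j : ZMod (7 * (4 * 53)), θ j =
      ((if Even j.val then (0 : ℤ) else J(-((53 : ℕ) : ℤ) | j.val) : ℤ) : ℚ_[7]) * ω (j.val : ZMod 7) ^ 4) :
    ‖generalizedBernoulli 1 θ‖ = 1 := by
  have hθ' : ∀ j : ZMod (7 * (4 * 53)), θ j =
      (((if j.val % 2 = 0 then (0 : ℤ) else if j.val % 4 = 1 then 1 else -1) * J((j.val : ℤ) | 53) : ℤ) : ℚ_[7]) * ω (j.val : ZMod 7) ^ 4 :=
    fun j => by rw [hθ j, kroneckerVal_n53_eq]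
  have hθ1 : θ ≠ 1 := by
    intro h1
    have hv := hθ' (((1483 : ℕ)) : ZMod (7 * (4 * 53)))
    have hval : (((1483 : ℕ) : ZMod (7 * (4 * 53)))).val = 1483 := by
      rw [ZMod.val_natCast]
    have h6 : (((1483 : ℕ)) : ZMod 7) = ((6 : ℕ) : ZMod 7) := by decide
    have hu : IsUnit (((1483 : ℕ)) : ZMod (7 * (4 * 53))) := by
      rw [ZMod.isUnit_iff_coprime]; norm_num
    rw [h1, hval, MulChar.one_apply hu, h6, apply_neg_one_pow_four, mul_one] at hv
    have hL : ((if (1483 : ℕ) % 2 = 0 then (0 : ℤ) else if (1483 : ℕ) % 4 = 1 then 1 else -1) * J(((1483 : ℕ) : ℤ) | 53)) = -1 := by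
      rw [jacobiSym_prime_eq_ite_nat 53 (by norm_num) (by norm_num)]; decide
    rw [hL] at hv
    norm_num at hv
  refine norm_generalizedBernoulli_one_eq_one_of_cert_range θ hθ1 padicValNat_seven_level1_n53
    (fun j => (if j % 2 = 0 then (0 : ℤ) else if j % 4 = 1 then 1 else -1) * J((j : ℤ) | 53)) 28 (fun j => ?_) (-425014302394838308857509410258031146877804928138252478550885109475916598960184077120410904744) ?_ (by norm_num) (by norm_num)
  · have := norm_sub_le_of_values ω hω θ (fun j => (if j % 2 = 0 then (0 : ℤ) else if j % 4 = 1 then 1 else -1) * J((j : ℤ) | 53)) 4 (by norm_num) hθ' j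
    simpa using this
  · simp_rw [jacobiSym_prime_eq_ite_nat 53 (by norm_num) (by norm_num)]; decide +kernel

set_option maxRecDepth 400000 in
/-- Block 0 of the `θ₂` certificate for `D = −212`, `r = 47`: `Σ_{0 ≤ j < 10000} χ_D(j)(j/47) j⁸` evaluated (`decide +kernel`). [folklore] -/
theorem theta2_n53_block0 :
    ∑ j ∈ Finset.Ico (0 : ℕ) (10000 : ℕ),
      ((if j % 2 = 0 then (0 : ℤ) else if j % 4 = 1 then 1 else -1) * J((j : ℤ) | 53) * J((j : ℤ) | 47)) * (j : ℤ) ^ (7 + 1) = (2270934951376884068502977767186018) := by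
  simp_rw [jacobiSym_prime_eq_ite_nat 53 (by norm_num) (by norm_num), jacobiSym_prime_eq_ite_nat 47 (by norm_num) (by norm_num)]
  decide +kernel

set_option maxRecDepth 400000 in
/-- Block 1 of the `θ₂` certificate for `D = −212`, `r = 47`: `Σ_{10000 ≤ j < 20000} χ_D(j)(j/47) j⁸` evaluated (`decide +kernel`). [folklore] -/
theorem theta2_n53_block1 :
    ∑ j ∈ Finset.Ico (10000 : ℕ) (20000 : ℕ),
      ((if j % 2 = 0 then (0 : ℤ) else if j % 4 = 1 then 1 else -1) * J((j : ℤ) | 53) * J((j : ℤ) | 47)) * (j : ℤ) ^ (7 + 1) = (505331047512325345873027439088052544) := by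
  simp_rw [jacobiSym_prime_eq_ite_nat 53 (by norm_num) (by norm_num), jacobiSym_prime_eq_ite_nat 47 (by norm_num) (by norm_num)]
  decide +kernel

set_option maxRecDepth 400000 in
/-- Block 2 of the `θ₂` certificate for `D = −212`, `r = 47`: `Σ_{20000 ≤ j < 30000} χ_D(j)(j/47) j⁸` evaluated (`decide +kernel`). [folklore] -/
theorem theta2_n53_block2 :
    ∑ j ∈ Finset.Ico (20000 : ℕ) (30000 : ℕ),
      ((if j % 2 = 0 then (0 : ℤ) else if j % 4 = 1 then 1 else -1) * J((j : ℤ) | 53) * J((j : ℤ) | 47)) * (j : ℤ) ^ (7 + 1) = (13566742842377932713503428528807191654) := by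
  simp_rw [jacobiSym_prime_eq_ite_nat 53 (by norm_num) (by norm_num), jacobiSym_prime_eq_ite_nat 47 (by norm_num) (by norm_num)]
  decide +kernel

set_option maxRecDepth 400000 in
/-- Block 3 of the `θ₂` certificate for `D = −212`, `r = 47`: `Σ_{30000 ≤ j < 40000} χ_D(j)(j/47) j⁸` evaluated (`decide +kernel`). [folklore] -/
theorem theta2_n53_block3 :
    ∑ j ∈ Finset.Ico (30000 : ℕ) (40000 : ℕ),
      ((if j % 2 = 0 then (0 : ℤ) else if j % 4 = 1 then 1 else -1) * J((j : ℤ) | 53) * J((j : ℤ) | 47)) * (j : ℤ) ^ (7 + 1) = (113707011903671935850266855763928068737) := by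
  simp_rw [jacobiSym_prime_eq_ite_nat 53 (by norm_num) (by norm_num), jacobiSym_prime_eq_ite_nat 47 (by norm_num) (by norm_num)]
  decide +kernel

set_option maxRecDepth 400000 in
/-- Block 4 of the `θ₂` certificate for `D = −212`, `r = 47`: `Σ_{40000 ≤ j < 50000} χ_D(j)(j/47) j⁸` evaluated (`decide +kernel`). [folklore] -/
theorem theta2_n53_block4 :
    ∑ j ∈ Finset.Ico (40000 : ℕ) (50000 : ℕ),
      ((if j % 2 = 0 then (0 : ℤ) else if j % 4 = 1 then 1 else -1) * J((j : ℤ) | 53) * J((j : ℤ) | 47)) * (j : ℤ) ^ (7 + 1) = (439702943261316925233257835386301233501) := by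
  simp_rw [jacobiSym_prime_eq_ite_nat 53 (by norm_num) (by norm_num), jacobiSym_prime_eq_ite_nat 47 (by norm_num) (by norm_num)]
  decide +kernel

set_option maxRecDepth 400000 in
/-- Block 5 of the `θ₂` certificate for `D = −212`, `r = 47`: `Σ_{50000 ≤ j < 60000} χ_D(j)(j/47) j⁸` evaluated (`decide +kernel`). [folklore] -/
theorem theta2_n53_block5 :
    ∑ j ∈ Finset.Ico (50000 : ℕ) (60000 : ℕ),
      ((if j % 2 = 0 then (0 : ℤ) else if j % 4 = 1 then 1 else -1) * J((j : ℤ) | 53) * J((j : ℤ) | 47)) * (j : ℤ) ^ (7 + 1) = (2648661578440802129309823250476836606374) := by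
  simp_rw [jacobiSym_prime_eq_ite_nat 53 (by norm_num) (by norm_num), jacobiSym_prime_eq_ite_nat 47 (by norm_num) (by norm_num)]
  decide +kernel

set_option maxRecDepth 400000 in
/-- Block 6 of the `θ₂` certificate for `D = −212`, `r = 47`: `Σ_{60000 ≤ j < 69748} χ_D(j)(j/47) j⁸` evaluated (`decide +kernel`). [folklore] -/
theorem theta2_n53_block6 :
    ∑ j ∈ Finset.Ico (60000 : ℕ) (7 * (4 * 53) * 47),
      ((if j % 2 = 0 then (0 : ℤ) else if j % 4 = 1 then 1 else -1) * J((j : ℤ) | 53) * J((j : ℤ) | 47)) * (j : ℤ) ^ (7 + 1) = (434687872123503539045263666668083622772) := by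
  simp_rw [jacobiSym_prime_eq_ite_nat 53 (by norm_num) (by norm_num), jacobiSym_prime_eq_ite_nat 47 (by norm_num) (by norm_num)]
  decide +kernel

/-- The `θ₂` certificate sum for `D = −212`, `r = 47` assembled from its 7 blocks; `7 ∥ S₂` (`S₂ ≡ 14 (mod 49)`). [folklore] -/
theorem theta2_n53_sum :
    ∑ j ∈ Finset.range (7 * (4 * 53) * 47),
      ((if j % 2 = 0 then (0 : ℤ) else if j % 4 = 1 then 1 else -1) * J((j : ℤ) | 53) * J((j : ℤ) | 47)) * (j : ℤ) ^ (7 + 1) = (3650833750554136164382056567240811961600) := by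
  rw [Finset.range_eq_Ico,
    ← Finset.sum_Ico_consecutive _ (show 0 ≤ 10000 by norm_num) (show 10000 ≤ 7 * (4 * 53) * 47 by norm_num),
    ← Finset.sum_Ico_consecutive _ (show 10000 ≤ 20000 by norm_num) (show 20000 ≤ 7 * (4 * 53) * 47 by norm_num),
    ← Finset.sum_Ico_consecutive _ (show 20000 ≤ 30000 by norm_num) (show 30000 ≤ 7 * (4 * 53) * 47 by norm_num),
    ← Finset.sum_Ico_consecutive _ (show 30000 ≤ 40000 by norm_num) (show 40000 ≤ 7 * (4 * 53) * 47 by norm_num),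
    ← Finset.sum_Ico_consecutive _ (show 40000 ≤ 50000 by norm_num) (show 50000 ≤ 7 * (4 * 53) * 47 by norm_num),
    ← Finset.sum_Ico_consecutive _ (show 50000 ≤ 60000 by norm_num) (show 60000 ≤ 7 * (4 * 53) * 47 by norm_num),
    theta2_n53_block0, theta2_n53_block1, theta2_n53_block2, theta2_n53_block3, theta2_n53_block4, theta2_n53_block5, theta2_n53_block6]
  norm_num

set_option maxRecDepth 400000 in
/-- **`‖B_{1,θ₂}‖₇ = 1`** for every character `θ₂` mod `7·212·47` with values `χ_{−212}(j)·(j/47)·ω(j)`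
(certificate `7 ∥ Σ_{j<69748} χ_{−212}(j)(j/47) j⁸`, `decide +kernel` in 7 blocks).
[cite: KrizLi2019, Thm. 1.20 (p. 8) and §1.5 (1)] [cite: Washington1997, §5.1 and Thm. 4.2] -/
theorem norm_generalizedBernoulli_theta2_n53 (ω : DirichletCharacter ℚ_[7] 7)
    (hω : IsTeichmullerCharacter ω) (θ : DirichletCharacter ℚ_[7] (7 * (4 * 53) * 47))
    (hθ : ∀ j : ZMod (7 * (4 * 53) * 47), θ j =
      (((if Even j.val then (0 : ℤ) else J(-((53 : ℕ) : ℤ) | j.val)) * J((j.val : ℤ) | 47) : ℤ) : ℚ_[7]) *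
        ω (j.val : ZMod 7) ^ 1) :
    ‖generalizedBernoulli 1 θ‖ = 1 := by
  have hθ' : ∀ j : ZMod (7 * (4 * 53) * 47), θ j =
      (((if j.val % 2 = 0 then (0 : ℤ) else if j.val % 4 = 1 then 1 else -1) * J((j.val : ℤ) | 53) * J((j.val : ℤ) | 47) : ℤ) : ℚ_[7]) * ω (j.val : ZMod 7) ^ 1 :=
    fun j => by rw [hθ j, kroneckerVal_n53_eq]
  have hθ1 : θ ≠ 1 := by
    intro h1
    have hv := hθ' (((69747 : ℕ)) : ZMod (7 * (4 * 53) * 47))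
    have hval : (((69747 : ℕ) : ZMod (7 * (4 * 53) * 47))).val = 69747 := by
      rw [ZMod.val_natCast]
    have hu : IsUnit (((69747 : ℕ)) : ZMod (7 * (4 * 53) * 47)) := by
      rw [ZMod.isUnit_iff_coprime]; norm_num
    rw [h1, hval, MulChar.one_apply hu, pow_one] at hv
    have hL : ((if (69747 : ℕ) % 2 = 0 then (0 : ℤ) else if (69747 : ℕ) % 4 = 1 then 1 else -1) * J(((69747 : ℕ) : ℤ) | 53) * J(((69747 : ℕ) : ℤ) | 47)) = 1 := by
      rw [jacobiSym_prime_eq_ite_nat 53 (by norm_num) (by norm_num), jacobiSym_prime_eq_ite_nat 47 (by norm_num) (by norm_num)]; decide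
    rw [hL, Int.cast_one, one_mul] at hv
    -- `ω(−1) = 1` contradicts `‖ω(6) − 6‖ < 1`
    have h6 : (((69747 : ℕ)) : ZMod 7) = ((6 : ℤ) : ZMod 7) := by decide
    rw [h6] at hv
    have hT := hω 6 (by decide)
    rw [← hv] at hT
    have : ‖(1 : ℚ_[7]) - ((6 : ℤ) : ℚ_[7])‖ = 1 := by
      rw [show (1 : ℚ_[7]) - ((6 : ℤ) : ℚ_[7]) = -((5 : ℕ) : ℚ_[7]) by norm_num, norm_neg]
      exact Padic.norm_natCast_eq_one_iff.mpr (by decide)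
    rw [this] at hT
    exact lt_irrefl _ hT
  refine norm_generalizedBernoulli_one_eq_one_of_cert_range θ hθ1 padicValNat_seven_level2_n53
    (fun j => (if j % 2 = 0 then (0 : ℤ) else if j % 4 = 1 then 1 else -1) * J((j : ℤ) | 53) * J((j : ℤ) | 47)) 7 (fun j => ?_) (3650833750554136164382056567240811961600)
    theta2_n53_sum (by norm_num) (by norm_num)
  have := norm_sub_le_of_values ω hω θ (fun j => (if j % 2 = 0 then (0 : ℤ) else if j % 4 = 1 then 1 else -1) * J((j : ℤ) | 53) * J((j : ℤ) | 47)) 1 le_rfl hθ' j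
  simpa using this

/-- **Member `n = 53` over `K = ℚ(√−47)`: every level-`N(W) = 784·53²` Heegner point of a globally minimal model `W` of
`49a1^{(−212)} ≅ 49a1^{(−53)}` (INERT half: `(−53/7) = −1`, the next inert-half PRIME of the family) has infinite order**, granted KL19 Thm. 1.20
only (the two certificates above). [cite: KrizLi2019, Thm. 1.20 (pp. 7–8) and Rem. 1.21] [cite: Washington1997, §5.1] -/
theorem not_isOfFinAddOrder_heegnerPoint_twist_cm7_neg212_of_thm120
    (h120 : KrizLi2019.thm120_padicLogHeegner_unit_of_bernoulli)
    (W : WeierstrassCurve ℚ) [W.IsElliptic] [W.IsGloballyMinimal]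
    (hW : ∃ C : VariableChange ℚ, C • W = cm7.quadraticTwist ((-(4 * ((53 : ℕ) : ℤ)) : ℤ) : ℚ))
    (K : Type) [Field K] [NumberField K] (hK : IsImaginaryQuadratic K) (hdK : NumberField.discr K = -((47 : ℕ) : ℤ))
    {P : (W.baseChange K).toAffine.Point}
    (hP : haveI : NeZero (W.conductorNorm ℤ) := ⟨(W.conductorNorm_pos_holds).ne'⟩
      IsHeegnerPoint (W.conductorNorm ℤ) W K P) : ¬ IsOfFinAddOrder P :=
  not_isOfFinAddOrder_heegnerPoint_twist_cm7_even_of_thm120 (n := 53) (r := 47) (hr := ⟨by norm_num⟩)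
    (by norm_num) (show Nat.Prime 53 by norm_num).squarefree (by norm_num) (by norm_num) (by norm_num) (by norm_num)
    (by rw [legendreSym_eq_ite 7 (by norm_num)]; decide)
    (fun q hq hqn _ => by rw [(Nat.prime_dvd_prime_iff_eq hq (by norm_num : Nat.Prime 53)).mp hqn, jacobiSym_prime_eq_ite 53 (by norm_num) (by norm_num)]; decide)
    norm_generalizedBernoulli_theta1_n53 norm_generalizedBernoulli_theta2_n53 h120 W hW K hK hdK hP

/-- **Member `n = 53`, K12₂″'s implication OUTRIGHT for the models of `49a1^{(−212)}` (INERT half):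
`corank_{ℤ₂} Sel_{2^∞}(W/ℚ) = 1 ⟹ ord_{s=1} L(W, s) = 1`** (auxiliary field `ℚ(√−47)`).
[cite: KrizLi2019, Thm. 1.20 (pp. 7–8)] [cite: GrossZagier1986, I.(6.3) and I.§7] [cite: DokchitserDokchitserAnnals2010, Thm. 1.4] -/
theorem rankOneTwoConverse_twist_cm7_neg212_of_thm120
    (h120 : KrizLi2019.thm120_padicLogHeegner_unit_of_bernoulli) (hnf : exists_isNewformOf)
    (hGZ : ∀ (N : ℕ) [NeZero N] (V : WeierstrassCurve ℚ) (L : Type) [Field L] [NumberField L], gross_zagier N V L)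
    (hHP : ∀ (V : WeierstrassCurve ℚ) (L : Type) [Field L] [NumberField L], exists_isHeegnerPoint V L)
    (hpar : ∀ (V : WeierstrassCurve ℚ) [V.IsElliptic], p_parity V 2)
    (W : WeierstrassCurve ℚ) [W.IsElliptic] [W.IsGloballyMinimal]
    (hW : ∃ C : VariableChange ℚ, C • W = cm7.quadraticTwist ((-(4 * ((53 : ℕ) : ℤ)) : ℤ) : ℚ))
    (hco : W.selmerCorank 2 = 1) : W.analyticRank = 1 :=
  rankOneTwoConverse_twist_cm7_even_of_thm120 (n := 53) (r := 47) (hr := ⟨by norm_num⟩)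
    (by norm_num) (show Nat.Prime 53 by norm_num).squarefree (by norm_num) (by norm_num) (by norm_num) (by norm_num)
    (by rw [legendreSym_eq_ite 7 (by norm_num)]; decide)
    (fun q hq hqn _ => by rw [(Nat.prime_dvd_prime_iff_eq hq (by norm_num : Nat.Prime 53)).mp hqn, jacobiSym_prime_eq_ite 53 (by norm_num) (by norm_num)]; decide)
    norm_generalizedBernoulli_theta1_n53 norm_generalizedBernoulli_theta2_n53 h120 hnf hGZ hHP hpar W hW hco

/-- **Member `n = 53`, unconditional shape: `r_an(W) ≤ 1`** for every globally minimal `W ≅ 49a1^{(−212)}` (so `r_an = 1` by the sign law,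
cone sequel). [cite: GrossZagier1986, I.§7] -/
theorem analyticRank_le_one_twist_cm7_neg212_of_thm120
    (h120 : KrizLi2019.thm120_padicLogHeegner_unit_of_bernoulli) (hnf : exists_isNewformOf)
    (hGZ : ∀ (N : ℕ) [NeZero N] (V : WeierstrassCurve ℚ) (L : Type) [Field L] [NumberField L], gross_zagier N V L)
    (hHP : ∀ (V : WeierstrassCurve ℚ) (L : Type) [Field L] [NumberField L], exists_isHeegnerPoint V L)
    (W : WeierstrassCurve ℚ) [W.IsElliptic] [W.IsGloballyMinimal]
    (hW : ∃ C : VariableChange ℚ, C • W = cm7.quadraticTwist ((-(4 * ((53 : ℕ) : ℤ)) : ℤ) : ℚ)) :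
    W.analyticRank ≤ 1 :=
  analyticRank_le_one_twist_cm7_even_of_thm120 (n := 53) (r := 47) (hr := ⟨by norm_num⟩)
    (by norm_num) (show Nat.Prime 53 by norm_num).squarefree (by norm_num) (by norm_num) (by norm_num) (by norm_num)
    (by rw [legendreSym_eq_ite 7 (by norm_num)]; decide)
    (fun q hq hqn _ => by rw [(Nat.prime_dvd_prime_iff_eq hq (by norm_num : Nat.Prime 53)).mp hqn, jacobiSym_prime_eq_ite 53 (by norm_num) (by norm_num)]; decide)
    norm_generalizedBernoulli_theta1_n53 norm_generalizedBernoulli_theta2_n53 h120 hnf hGZ hHP W hW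

end Summit.BirchSwinnertonDyer.BirchSwinnertonDyer.Theorems.GoldfeldGoodTwists

end
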